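import Literature.Barriers.NavierStokesRegularity.HypodissipativeLerayNonuniquenessLerayExistence
import Literature.Analysis.FluidPDE.FractionalNSPrescribedEnergyFamilies
import Literature.Analysis.FluidPDE.FractionalNSPrescribedEnergyProfiles
import Literature.Analysis.FluidPDE.FractionalNSPrescribedEnergyProofs
import HarnessLib

/-!
# Colombo–De Lellis–De Rosa 2018, Thm. 1.3 from Prop. 2.2 and Cor. 11.2 (the printed proof of
  §2), and Thm. 1.2 from Prop. 2.2 alone

Third sibling proof file (theorems only, no definitions, no notation) of the barrier entry
`Literature/Barriers/NavierStokesRegularity/HypodissipativeLerayNonuniqueness` (D-0021), after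
`HypodissipativeLerayNonuniquenessProofs` (Thms. 1.1, 1.3 as named facts; "Thm. 1.1 + Thm. 1.3 ⇒
Thm. 1.2" proved) and `HypodissipativeLerayNonuniquenessLerayExistence` (Thm. 1.1 discharged;
`ColomboDeLellisDeRosa2018_thm12_of_thm13`). Here the local theorem **Thm. 1.3**
(`ColomboDeLellisDeRosa2018_thm13`) **is proved from the paper's Prop. 2.2** — the
convex-integration output with prescribed energy profiles, the named fact
`Literature.Analysis.FluidPDE.ColomboDeLellisDeRosa2018_prop22` of
`Literature/Analysis/FluidPDE/FractionalNSPrescribedEnergyFamilies` — **and Cor. 11.2**, which is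
word for word De Rosa's Cor. 7.2 (`Literature.Analysis.FluidPDE.DeRosa2019_cor72`, PROVED in the
tree: `DeRosa2019_cor72_holds`), following the printed proof (§2, pp. 5–6 of the held arXiv text):

1. fix `α < 1/5`; take `ε ≤ ε₀(α)` with `α + ε < 1/5` and `4α + 6ε < 1` ("we next fix `ε` so
   small that `γ < 1`"), the window constants `c₀, T₀` and the constant `C(α,ε)` of Prop. 2.2 (c),
   and the constant `C(ε)` of Cor. 11.2;
2. "Elementary arguments produce for every `K > 1` an infinite set `𝓔_K` of smooth functions"
   with common `e(0)`, `e'(0)`, a window, derivative bounds and a steep initial decrease: here the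
   explicit profiles `e_n(t) = c₀ - (c₀/4)(1 - e^{-4Kt/c₀}) - η_n t²`, `η_n = η₀/(n+2)` — value
   `c₀` and slope `-K` at `t = 0`, `c₀/2 ≤ e_n ≤ c₀` on `[0,T₀]`, slope `≤ -K/3` on `[0,T]`,
   `T = c₀/(4K)`, `|e_n'| ≤ K + 1`, `|e_n''| ≤ 4K²/c₀ + 1`, pairwise distinct at `t = T` — written
   out in full in every statement (no definition is introduced), and packaged as an admissible
   family `IsEnergyProfileFamily c₀ T₀ E₁ E₂` with `E₁ = (K+1)T₀/c₀`,
   `E₂ = max E₁ ((4K²/c₀+1)T₀²/c₀)`;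
3. Prop. 2.2 gives solutions `v_n` on `[0,T₀]` with `∫|v_n(t)|² = e_n(t)`, one common datum
   `v̄ = v_n(0)`, and `‖v_n(t)‖_∞ + [v_n(t)]_{α+ε} ≤ C max{E₁^{2α+3ε}, E₂^{(2α+4ε)/3}} ≲ K^{2α+3ε}`;
4. Cor. 11.2: `∫|(-Δ)^{α/2}v_n(τ)|² ≤ C(ε)(‖v_n(τ)‖_∞ + [v_n(τ)]_{α+ε})² ≲ K^{4α+6ε} ≤ K/6` for
   `K` large ("choosing `K` large enough we clearly achieve" the dissipation bound, p. 6: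
   `exists_large_parameter`);
5. hence for `0 ≤ s ≤ t ≤ T`: `½e_n(t) + ∫ₛᵗ∫|(-Δ)^{α/2}v_n|² ≤ ½e_n(t) + (K/6)(t-s) ≤ ½e_n(s)`,
   the energy inequality (3) on `[0,T]` (the tree's
   `Literature.Analysis.FluidPDE.fracEnergyIneq_of_profile`); the datum is `C^{α+ε}`, in `L²` and
   weakly divergence free (continuity from a.e. `t`), and the `v_n` are pairwise distinct on
   `[0,T]` because their energies differ at `T` ("by (vi) they are all distinct").

Consequence: `ColomboDeLellisDeRosa2018_thm12_of_prop22` — Thm. 1.2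
(`ColomboDeLellisDeRosa2018_thm12`: for `α < 1/5` some divergence-free `v̄ ∈ L²(𝕋³)` carries
infinitely many Leray solutions) now rests on the convex-integration proposition Prop. 2.2 alone,
Thm. 1.1, Cor. 11.2, the profile family and the continuation remark all being proved.

Remark on the printed list (i)–(vi) of the proof of Thm. 1.3: it asks `‖e‖_{C²} ≤ CK²` together
with `e' ≤ -2K + 2` on `[0, 1/4K]`, which no profile with `½ ≤ e ≤ 1` satisfies for large `K`
(the drop on that window alone is `½ - 1/2K`); the argument only needs some window of length
`≍ 1/K` on which the slope is `≤ -cK`, with `E₁ ≲ K`, `E₂ ≲ K²`, which the profiles above provide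
(window `[0, c₀/4K]`, slope `≤ -K/3`).

## References

* M. Colombo, C. De Lellis, L. De Rosa, *Ill-posedness of Leray solutions for the hypodissipative
  Navier–Stokes equations*, Comm. Math. Phys. 362 (2018), 659–688 (held: arXiv:1708.05666): §1
  Thms. 1.1–1.3 (p. 3); §2 Prop. 2.2 and the proof of Thm. 1.3 (pp. 5–6); §11 Cor. 11.2 (p. 22).
  [`ColomboDelellisDerosa2018`]
* L. De Rosa, Comm. PDE 44 (2019), 335–365 (held: arXiv:1801.10235), §7 Cor. 7.2. [`Derosa2018`]
-/

noncomputable section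

open MeasureTheory Set Filter Function
open Literature.Analysis.FluidPDE Literature.Analysis.FunctionSpaces
open scoped ENNReal NNReal Topology

namespace Literature.Barriers.NavierStokesRegularity

/-! ## The steep energy profiles `e(t) = c₀ - (c₀/4)(1 - exp(-4Kt/c₀)) - ηt²` -/

section Profiles

/-- The steep profiles are smooth. [folklore] -/
theorem contDiff_steepProfile (c₀ K η : ℝ) {n : WithTop ℕ∞} :
    ContDiff ℝ n (fun t : ℝ => c₀ - c₀ / 4 * (1 - Real.exp (-(4 * K / c₀) * t)) - η * t ^ 2) := by
  fun_prop

/-- The derivative of a steep profile: `e'(t) = -K exp(-4Kt/c₀) - 2ηt` (`c₀ ≠ 0`). [folklore] -/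
theorem hasDerivAt_steepProfile {c₀ : ℝ} (hc₀ : c₀ ≠ 0) (K η t : ℝ) :
    HasDerivAt (fun t : ℝ => c₀ - c₀ / 4 * (1 - Real.exp (-(4 * K / c₀) * t)) - η * t ^ 2)
      (-K * Real.exp (-(4 * K / c₀) * t) - 2 * η * t) t := by
  have h1 : HasDerivAt (fun t => -(4 * K / c₀) * t) (-(4 * K / c₀)) t := by
    simpa using (hasDerivAt_id t).const_mul (-(4 * K / c₀))
  have h2 : HasDerivAt (fun t => Real.exp (-(4 * K / c₀) * t))
      (Real.exp (-(4 * K / c₀) * t) * (-(4 * K / c₀))) t := h1.exp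
  have h3 : HasDerivAt (fun t => η * t ^ 2) (η * (2 * t)) t := by
    simpa using (hasDerivAt_pow 2 t).const_mul η
  refine (((hasDerivAt_const t c₀).sub (((hasDerivAt_const t (1 : ℝ)).sub h2).const_mul
    (c₀ / 4))).sub h3).congr_deriv ?_
  field_simp
  ring

/-- The derivative of a steep profile, as a function. [folklore] -/
theorem deriv_steepProfile {c₀ : ℝ} (hc₀ : c₀ ≠ 0) (K η : ℝ) :
    deriv (fun t : ℝ => c₀ - c₀ / 4 * (1 - Real.exp (-(4 * K / c₀) * t)) - η * t ^ 2) =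
      fun t => -K * Real.exp (-(4 * K / c₀) * t) - 2 * η * t :=
  funext fun t => (hasDerivAt_steepProfile hc₀ K η t).deriv

/-- The slope of a steep profile at `t = 0` is `-K`, independently of `η`. [folklore] -/
theorem deriv_steepProfile_zero {c₀ : ℝ} (hc₀ : c₀ ≠ 0) (K η : ℝ) :
    deriv (fun t : ℝ => c₀ - c₀ / 4 * (1 - Real.exp (-(4 * K / c₀) * t)) - η * t ^ 2) 0 = -K := by
  rw [deriv_steepProfile hc₀]
  simp

/-- The second derivative of a steep profile: `e''(t) = (4K²/c₀) exp(-4Kt/c₀) - 2η`. [folklore] -/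
theorem iteratedDeriv_two_steepProfile {c₀ : ℝ} (hc₀ : c₀ ≠ 0) (K η : ℝ) :
    iteratedDeriv 2 (fun t : ℝ => c₀ - c₀ / 4 * (1 - Real.exp (-(4 * K / c₀) * t)) - η * t ^ 2) =
      fun t => 4 * K ^ 2 / c₀ * Real.exp (-(4 * K / c₀) * t) - 2 * η := by
  rw [iteratedDeriv_succ, iteratedDeriv_one, deriv_steepProfile hc₀]
  refine funext fun t => ?_
  have h1 : HasDerivAt (fun t => -(4 * K / c₀) * t) (-(4 * K / c₀)) t := by
    simpa using (hasDerivAt_id t).const_mul (-(4 * K / c₀))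
  have h2 : HasDerivAt (fun t => Real.exp (-(4 * K / c₀) * t))
      (Real.exp (-(4 * K / c₀) * t) * (-(4 * K / c₀))) t := h1.exp
  have h3 : HasDerivAt (fun t => 2 * η * t) (2 * η) t := by
    simpa using (hasDerivAt_id t).const_mul (2 * η)
  refine (((h2.const_mul (-K)).sub h3).congr_deriv ?_).deriv
  field_simp

/-- The steep profiles start at `c₀`. [folklore] -/
theorem steepProfile_zero (c₀ K η : ℝ) :
    (fun t : ℝ => c₀ - c₀ / 4 * (1 - Real.exp (-(4 * K / c₀) * t)) - η * t ^ 2) 0 = c₀ := by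
  simp

/-- For `c₀ > 0`, `K, t ≥ 0`: `exp(-4Kt/c₀) ≤ 1`. [folklore] -/
theorem exp_steep_le_one {c₀ K t : ℝ} (hc₀ : 0 < c₀) (hK : 0 ≤ K) (ht : 0 ≤ t) :
    Real.exp (-(4 * K / c₀) * t) ≤ 1 := by
  apply Real.exp_le_one_iff.2
  have : 0 ≤ 4 * K / c₀ * t := by positivity
  linarith

/-- The window: `c₀/2 ≤ e(t) ≤ c₀` for `t ∈ [0, T₀]` (`c₀ > 0`, `K, η ≥ 0`, `ηT₀² ≤ c₀/4`). [folklore] -/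
theorem steepProfile_mem_Icc {c₀ K η T₀ t : ℝ} (hc₀ : 0 < c₀) (hK : 0 ≤ K) (hη : 0 ≤ η)
    (hηT₀ : η * T₀ ^ 2 ≤ c₀ / 4) (ht : t ∈ Icc 0 T₀) :
    (fun t : ℝ => c₀ - c₀ / 4 * (1 - Real.exp (-(4 * K / c₀) * t)) - η * t ^ 2) t ∈
      Icc (c₀ / 2) c₀ := by
  have h0 : 0 ≤ Real.exp (-(4 * K / c₀) * t) := (Real.exp_pos _).le
  have h1 := exp_steep_le_one hc₀ hK ht.1
  have h2 : η * t ^ 2 ≤ η * T₀ ^ 2 := mul_le_mul_of_nonneg_left (pow_le_pow_left₀ ht.1 ht.2 2) hη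
  simp only [mem_Icc]
  constructor <;> nlinarith [sq_nonneg t]

/-- **Steepness on the initial window**: for `0 ≤ t ≤ c₀/(4K)` the slope is at most `-K/3`
(indeed `≤ -Ke⁻¹`; `c₀ > 0`, `K, η ≥ 0`). [folklore] -/
theorem deriv_steepProfile_le {c₀ K η t : ℝ} (hc₀ : 0 < c₀) (hK : 0 ≤ K) (hη : 0 ≤ η)
    (ht : 0 ≤ t) (htK : t ≤ c₀ / (4 * K)) :
    deriv (fun t : ℝ => c₀ - c₀ / 4 * (1 - Real.exp (-(4 * K / c₀) * t)) - η * t ^ 2) t ≤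
      -(K / 3) := by
  rw [deriv_steepProfile hc₀.ne']
  dsimp only
  have hexp : (1 : ℝ) / 3 ≤ Real.exp (-(4 * K / c₀) * t) := by
    have harg : -1 ≤ -(4 * K / c₀) * t := by
      rcases eq_or_lt_of_le hK with rfl | hKpos
      · simp
      · have h1 : 4 * K / c₀ * t ≤ 4 * K / c₀ * (c₀ / (4 * K)) :=
          mul_le_mul_of_nonneg_left htK (by positivity)
        have h2 : 4 * K / c₀ * (c₀ / (4 * K)) = 1 := by field_simp
        linarith
    have h3 : Real.exp (-1) ≤ Real.exp (-(4 * K / c₀) * t) := Real.exp_le_exp.2 harg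
    have h4 : (1 : ℝ) / 3 ≤ Real.exp (-1) := by
      rw [Real.exp_neg, div_le_iff₀ (by norm_num : (0 : ℝ) < 3), inv_mul_eq_div,
        le_div_iff₀ (Real.exp_pos 1)]
      have := Real.exp_one_lt_d9
      linarith
    linarith
  nlinarith [mul_nonneg hη ht]

/-- First-derivative bound: `|e'(t)| ≤ K + 2ηT₀` on `[0, T₀]` (`c₀ > 0`, `K, η ≥ 0`). [folklore] -/
theorem abs_deriv_steepProfile_le {c₀ K η T₀ t : ℝ} (hc₀ : 0 < c₀) (hK : 0 ≤ K) (hη : 0 ≤ η)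
    (ht : t ∈ Icc 0 T₀) :
    |deriv (fun t : ℝ => c₀ - c₀ / 4 * (1 - Real.exp (-(4 * K / c₀) * t)) - η * t ^ 2) t| ≤
      K + 2 * η * T₀ := by
  rw [deriv_steepProfile hc₀.ne']
  dsimp only
  have h0 : 0 ≤ Real.exp (-(4 * K / c₀) * t) := (Real.exp_pos _).le
  have h1 := exp_steep_le_one hc₀ hK ht.1
  rw [abs_le]
  constructor <;> nlinarith [mul_nonneg hη ht.1, mul_le_mul_of_nonneg_left ht.2 hη]

/-- Second-derivative bound: `|e''(t)| ≤ 4K²/c₀ + 2η` for `t ≥ 0` (`c₀ > 0`, `K, η ≥ 0`). [folklore] -/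
theorem abs_iteratedDeriv_two_steepProfile_le {c₀ K η t : ℝ} (hc₀ : 0 < c₀) (hK : 0 ≤ K)
    (hη : 0 ≤ η) (ht : 0 ≤ t) :
    |iteratedDeriv 2 (fun t : ℝ => c₀ - c₀ / 4 * (1 - Real.exp (-(4 * K / c₀) * t)) - η * t ^ 2) t| ≤
      4 * K ^ 2 / c₀ + 2 * η := by
  rw [iteratedDeriv_two_steepProfile hc₀.ne']
  dsimp only
  have h0 : 0 ≤ Real.exp (-(4 * K / c₀) * t) := (Real.exp_pos _).le
  have h1 := exp_steep_le_one hc₀ hK ht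
  have hA : 0 ≤ 4 * K ^ 2 / c₀ := by positivity
  rw [abs_le]
  constructor <;> nlinarith [mul_le_mul_of_nonneg_left h1 hA, mul_nonneg hA h0]

/-- Steep profiles with different `η` differ at every time `t ≠ 0` (they differ by
`(η₂ - η₁)t²`). [folklore] -/
theorem steepProfile_ne {c₀ K η₁ η₂ t : ℝ} (hη : η₁ ≠ η₂) (ht : t ≠ 0) :
    (fun t : ℝ => c₀ - c₀ / 4 * (1 - Real.exp (-(4 * K / c₀) * t)) - η₁ * t ^ 2) t ≠
      (fun t : ℝ => c₀ - c₀ / 4 * (1 - Real.exp (-(4 * K / c₀) * t)) - η₂ * t ^ 2) t := by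
  intro h
  have h1 : (η₂ - η₁) * t ^ 2 = 0 := by
    simp only at h
    linarith
  exact (mul_ne_zero (sub_ne_zero.2 (Ne.symm hη)) (pow_ne_zero 2 ht)) h1

/-- **The steep profiles form an admissible family** in the sense of
`Literature.Analysis.FluidPDE.IsEnergyProfileFamily` (hypotheses (i)–(v) of CDLDR Prop. 2.2):
for `c₀, T₀ > 0`, `K ≥ 0`, parameters `0 ≤ η n ≤ η₀` with `η₀T₀² ≤ c₀/4`, and any `E₁, E₂` with
`K + 2η₀T₀ ≤ c₀E₁/T₀`, `4K²/c₀ + 2η₀ ≤ c₀E₂/T₀²`.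
[cite: ColomboDelellisDerosa2018, §2 proof of Thm. 1.3 (i)–(vi)] -/
theorem isEnergyProfileFamily_steepProfile {c₀ T₀ K η₀ E₁ E₂ : ℝ} (hc₀ : 0 < c₀) (hT₀ : 0 < T₀)
    (hK : 0 ≤ K) (hη₀T₀ : η₀ * T₀ ^ 2 ≤ c₀ / 4) {η : ℕ → ℝ} (hη : ∀ n, 0 ≤ η n ∧ η n ≤ η₀)
    (hE₁ : K + 2 * η₀ * T₀ ≤ c₀ * E₁ / T₀) (hE₂ : 4 * K ^ 2 / c₀ + 2 * η₀ ≤ c₀ * E₂ / T₀ ^ 2) :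
    IsEnergyProfileFamily c₀ T₀ E₁ E₂ (Set.range fun n : ℕ =>
      fun t : ℝ => c₀ - c₀ / 4 * (1 - Real.exp (-(4 * K / c₀) * t)) - η n * t ^ 2) where
  contDiff e he := by
    obtain ⟨n, rfl⟩ := he
    exact contDiff_steepProfile c₀ K (η n)
  lower e he t ht := by
    obtain ⟨n, rfl⟩ := he
    exact (steepProfile_mem_Icc hc₀ hK (hη n).1
      ((mul_le_mul_of_nonneg_right (hη n).2 (sq_nonneg _)).trans hη₀T₀) ht).1
  upper e he t ht := by
    obtain ⟨n, rfl⟩ := he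
    exact (steepProfile_mem_Icc hc₀ hK (hη n).1
      ((mul_le_mul_of_nonneg_right (hη n).2 (sq_nonneg _)).trans hη₀T₀) ht).2
  apply_zero_eq e₁ he₁ e₂ he₂ := by
    obtain ⟨n₁, rfl⟩ := he₁
    obtain ⟨n₂, rfl⟩ := he₂
    simp
  deriv_zero_eq e₁ he₁ e₂ he₂ := by
    obtain ⟨n₁, rfl⟩ := he₁
    obtain ⟨n₂, rfl⟩ := he₂
    dsimp only
    rw [deriv_steepProfile_zero hc₀.ne', deriv_steepProfile_zero hc₀.ne']
  abs_deriv_le e he t ht := by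
    obtain ⟨n, rfl⟩ := he
    refine (abs_deriv_steepProfile_le hc₀ hK (hη n).1 ht).trans (le_trans ?_ hE₁)
    nlinarith [(hη n).2, hT₀.le]
  abs_iteratedDeriv_two_le e he t ht := by
    obtain ⟨n, rfl⟩ := he
    refine (abs_iteratedDeriv_two_steepProfile_le hc₀ hK (hη n).1 ht.1).trans (le_trans ?_ hE₂)
    linarith [(hη n).2]

end Profiles

/-! ## Choice of the large parameter `K` -/

/-- **"Choosing `K` large enough"** (proof of Thm. 1.3, p. 6): for exponents `0 ≤ p ≤ γ/2`,
`0 ≤ 2q ≤ γ/2`, `γ < 1`, window constants `c₀, T₀ > 0` and constants `C, C₇ ≥ 0` there is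
`K ≥ max(1, c₀/T₀)` such that, with `E₁ = (K+1)T₀/c₀` and `E₂ = max E₁ ((4K²/c₀+1)T₀²/c₀)`,
`6 C₇ (C max{E₁^p, E₂^q})² ≤ K` (the dissipation bound `≲ K^γ` against the slope `K`).
[cite: ColomboDelellisDerosa2018, §2 proof of Thm. 1.3 (p. 6)] -/
theorem exists_large_parameter {c₀ T₀ C C₇ p q γ : ℝ} (hc₀ : 0 < c₀) (hT₀ : 0 < T₀) (hC : 0 ≤ C)
    (hC₇ : 0 ≤ C₇) (hp : 0 ≤ p) (hpγ : p ≤ γ / 2) (hq : 0 ≤ q) (hqγ : 2 * q ≤ γ / 2) (hγ : γ < 1) :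
    ∃ K : ℝ, 1 ≤ K ∧ c₀ / T₀ ≤ K ∧
      6 * (C₇ * (C * max (((K + 1) * T₀ / c₀) ^ p)
        ((max ((K + 1) * T₀ / c₀) ((4 * K ^ 2 / c₀ + 1) * T₀ ^ 2 / c₀)) ^ q)) ^ 2) ≤ K := by
  -- the constants
  set A₁ : ℝ := max 1 (2 * T₀ / c₀) with hA₁_def
  have hA₁1 : 1 ≤ A₁ := le_max_left _ _
  have hA₁0 : 0 ≤ A₁ := zero_le_one.trans hA₁1
  set A₂ : ℝ := max A₁ ((4 / c₀ + 1) * T₀ ^ 2 / c₀) with hA₂_def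
  have hA₂1 : 1 ≤ A₂ := hA₁1.trans (le_max_left _ _)
  have hA₂0 : 0 ≤ A₂ := zero_le_one.trans hA₂1
  set L : ℝ := 6 * (C₇ * (C * A₂) ^ 2) with hL_def
  have hL0 : 0 ≤ L := by positivity
  have h1γ : 0 < 1 - γ := by linarith
  have hγ0 : 0 ≤ γ := by linarith
  set K₁ : ℝ := (L + 1) ^ (1 / (1 - γ)) with hK₁_def
  set K : ℝ := max (max 1 (c₀ / T₀)) K₁ with hK_def
  have hK1 : 1 ≤ K := (le_max_left _ _).trans (le_max_left _ _)
  have hK0 : 0 < K := zero_lt_one.trans_le hK1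
  have hKT₀ : c₀ / T₀ ≤ K := (le_max_right _ _).trans (le_max_left _ _)
  have hKK₁ : K₁ ≤ K := le_max_right _ _
  refine ⟨K, hK1, hKT₀, ?_⟩
  -- `K^{1-γ} ≥ L`
  have hpow : L ≤ K ^ (1 - γ) := by
    have h1 : L + 1 ≤ K₁ ^ (1 - γ) := by
      rw [hK₁_def, ← Real.rpow_mul (by positivity), one_div_mul_cancel h1γ.ne', Real.rpow_one]
    have h2 : K₁ ^ (1 - γ) ≤ K ^ (1 - γ) := Real.rpow_le_rpow (by positivity) hKK₁ h1γ.le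
    linarith
  have hKγ : 0 ≤ K ^ (γ / 2) := by positivity
  -- `E₁ ≤ A₁ K`, `E₂ ≤ A₂ K²`
  set E₁ : ℝ := (K + 1) * T₀ / c₀ with hE₁_def
  set E₂ : ℝ := max E₁ ((4 * K ^ 2 / c₀ + 1) * T₀ ^ 2 / c₀) with hE₂_def
  have hE₁0 : 0 ≤ E₁ := by positivity
  have hE₁A : E₁ ≤ A₁ * K := by
    calc E₁ ≤ 2 * K * T₀ / c₀ := by
          rw [hE₁_def]
          exact div_le_div_of_nonneg_right (by nlinarith) hc₀.le
      _ = (2 * T₀ / c₀) * K := by ring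
      _ ≤ A₁ * K := mul_le_mul_of_nonneg_right (le_max_right _ _) hK0.le
  have hK2 : K ≤ K ^ 2 := by nlinarith
  have hE₂A : E₂ ≤ A₂ * K ^ 2 := by
    refine max_le ?_ ?_
    · calc E₁ ≤ A₁ * K := hE₁A
        _ ≤ A₁ * K ^ 2 := mul_le_mul_of_nonneg_left hK2 hA₁0
        _ ≤ A₂ * K ^ 2 := mul_le_mul_of_nonneg_right (le_max_left _ _) (by positivity)
    · calc (4 * K ^ 2 / c₀ + 1) * T₀ ^ 2 / c₀ ≤ ((4 / c₀ + 1) * K ^ 2) * T₀ ^ 2 / c₀ := by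
            apply div_le_div_of_nonneg_right _ hc₀.le
            apply mul_le_mul_of_nonneg_right _ (sq_nonneg _)
            have : (4 / c₀ + 1) * K ^ 2 = 4 * K ^ 2 / c₀ + K ^ 2 := by ring
            rw [this]
            nlinarith
        _ = ((4 / c₀ + 1) * T₀ ^ 2 / c₀) * K ^ 2 := by ring
        _ ≤ A₂ * K ^ 2 := mul_le_mul_of_nonneg_right (le_max_right _ _) (by positivity)
  -- the two terms of the maximum are `≤ A₂ K^{γ/2}`
  have hT₁ : E₁ ^ p ≤ A₂ * K ^ (γ / 2) := by
    calc E₁ ^ p ≤ (A₁ * K) ^ p := Real.rpow_le_rpow hE₁0 hE₁A hp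
      _ = A₁ ^ p * K ^ p := Real.mul_rpow hA₁0 hK0.le
      _ ≤ A₁ * K ^ (γ / 2) := by
          apply mul_le_mul _ _ (by positivity) hA₁0
          · calc A₁ ^ p ≤ A₁ ^ (1 : ℝ) := Real.rpow_le_rpow_of_exponent_le hA₁1 (by linarith)
              _ = A₁ := Real.rpow_one A₁
          · exact Real.rpow_le_rpow_of_exponent_le hK1 hpγ
      _ ≤ A₂ * K ^ (γ / 2) := mul_le_mul_of_nonneg_right (le_max_left _ _) hKγ
  have hT₂ : E₂ ^ q ≤ A₂ * K ^ (γ / 2) := by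
    have hE₂0 : 0 ≤ E₂ := hE₁0.trans (le_max_left _ _)
    calc E₂ ^ q ≤ (A₂ * K ^ 2) ^ q := Real.rpow_le_rpow hE₂0 hE₂A hq
      _ = A₂ ^ q * (K ^ 2) ^ q := Real.mul_rpow hA₂0 (by positivity)
      _ = A₂ ^ q * K ^ (2 * q) := by
          rw [show (K ^ 2 : ℝ) = K ^ (2 : ℝ) from (Real.rpow_natCast K 2).symm,
            ← Real.rpow_mul hK0.le]
      _ ≤ A₂ * K ^ (γ / 2) := by
          apply mul_le_mul _ _ (by positivity) hA₂0
          · calc A₂ ^ q ≤ A₂ ^ (1 : ℝ) := Real.rpow_le_rpow_of_exponent_le hA₂1 (by linarith)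
              _ = A₂ := Real.rpow_one A₂
          · exact Real.rpow_le_rpow_of_exponent_le hK1 hqγ
  have hmax : max (E₁ ^ p) (E₂ ^ q) ≤ A₂ * K ^ (γ / 2) := max_le hT₁ hT₂
  have hmax0 : 0 ≤ max (E₁ ^ p) (E₂ ^ q) := le_trans (by positivity) (le_max_left _ _)
  have hsq : (K ^ (γ / 2)) ^ 2 = K ^ γ := by
    rw [sq, ← Real.rpow_add hK0]
    ring_nf
  calc 6 * (C₇ * (C * max (E₁ ^ p) (E₂ ^ q)) ^ 2)
      ≤ 6 * (C₇ * (C * (A₂ * K ^ (γ / 2))) ^ 2) := by gcongr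
    _ = L * K ^ γ := by rw [hL_def, ← hsq]; ring
    _ ≤ K ^ (1 - γ) * K ^ γ := mul_le_mul_of_nonneg_right hpow (by positivity)
    _ = K := by rw [← Real.rpow_add hK0]; norm_num

/-! ## Thm. 1.3 from Prop. 2.2 and Cor. 11.2 -/

/-- **Colombo–De Lellis–De Rosa 2018, Thm. 1.3 from Prop. 2.2** (the printed proof, §2 pp. 5–6):
the convex-integration output with prescribed energy profiles
(`Literature.Analysis.FluidPDE.ColomboDeLellisDeRosa2018_prop22`) and the Hölder bound on the
fractional dissipation (Cor. 11.2 = De Rosa's Cor. 7.2, proved: `DeRosa2019_cor72_holds`) imply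
that for every `α ∈ (0, 1/5)` there are a `C^β` datum, `α < β < 1/5`, a time `T > 0` and
infinitely many `C^β` solutions on `𝕋³ × [0,T]` from it obeying the energy inequality for all
`0 ≤ s ≤ t ≤ T` (`ColomboDeLellisDeRosa2018_thm13`). See the module docstring for the five steps.
[cite: ColomboDelellisDerosa2018, §2 proof of Thm. 1.3 (pp. 5–6)] -/
theorem ColomboDeLellisDeRosa2018_thm13_of_prop22 (h22 : ColomboDeLellisDeRosa2018_prop22) :
    ColomboDeLellisDeRosa2018_thm13 := by
  intro α hα hα5
  obtain ⟨ε₀, hε₀, h22⟩ := h22 α hα hα5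
  -- Step 1: the exponent `ε` and the constants of Prop. 2.2 (c) and Cor. 11.2
  set ε : ℝ := min ε₀ (min ((1 / 5 - α) / 2) ((1 - 4 * α) / 12)) with hε_def
  have hε : 0 < ε := by
    refine lt_min hε₀ (lt_min ?_ ?_) <;> linarith
  have hεε₀ : ε ≤ ε₀ := min_le_left _ _
  have hαε : α + ε < 1 / 5 := by
    have : ε ≤ (1 / 5 - α) / 2 := (min_le_right _ _).trans (min_le_left _ _)
    linarith
  have hγ1 : 4 * α + 6 * ε < 1 := by
    have : ε ≤ (1 - 4 * α) / 12 := (min_le_right _ _).trans (min_le_right _ _)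
    linarith
  obtain ⟨c₀, T₀, C, hc₀, hT₀, hC, h22⟩ := h22 ε hε hεε₀ hαε
  obtain ⟨C₇, hC₇, hcor⟩ := DeRosa2019_cor72_holds α ε hα (by linarith) hε (by linarith)
  -- Step 4 (choice of `K`): exponents `p = 2α+3ε`, `q = (2α+4ε)/3`, `γ = 4α+6ε`
  obtain ⟨K, hK1, hKT₀, hKD⟩ := exists_large_parameter (c₀ := c₀) (T₀ := T₀) (C := C)
    (C₇ := C₇) (p := 2 * α + 3 * ε) (q := (2 * α + 4 * ε) / 3) (γ := 4 * α + 6 * ε) hc₀ hT₀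
    hC.le hC₇.le (by positivity) (by linarith) (by positivity) (by linarith) hγ1
  have hK0 : 0 < K := zero_lt_one.trans_le hK1
  -- the parameters of Prop. 2.2
  set E₁ : ℝ := (K + 1) * T₀ / c₀ with hE₁_def
  set E₂ : ℝ := max E₁ ((4 * K ^ 2 / c₀ + 1) * T₀ ^ 2 / c₀) with hE₂_def
  have hE₁1 : 1 < E₁ := by
    rw [hE₁_def, lt_div_iff₀ hc₀]
    rw [div_le_iff₀ hT₀] at hKT₀
    nlinarith
  have hE₁E₂ : E₁ ≤ E₂ := le_max_left _ _
  -- the window `[0, T]`, `T = c₀/(4K) ≤ T₀`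
  set T : ℝ := c₀ / (4 * K) with hT_def
  have hT : 0 < T := by positivity
  have hTT₀ : T ≤ T₀ := by
    rw [hT_def, div_le_iff₀ (by positivity)]
    rw [div_le_iff₀ hT₀] at hKT₀
    nlinarith
  -- Step 2: the family of steep profiles
  set η₀ : ℝ := min (c₀ / (4 * T₀ ^ 2)) (min (1 / (2 * T₀)) (1 / 2)) with hη₀_def
  have hη₀ : 0 < η₀ := lt_min (by positivity) (lt_min (by positivity) (by norm_num))
  set η : ℕ → ℝ := fun n => η₀ / (n + 2) with hη_def
  have hηpos : ∀ n, 0 < η n := fun n => by positivity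
  have hη : ∀ n, 0 ≤ η n ∧ η n ≤ η₀ := fun n => by
    refine ⟨(hηpos n).le, ?_⟩
    rw [hη_def]
    dsimp only
    rw [div_le_iff₀ (by positivity)]
    have : (0 : ℝ) ≤ n := n.cast_nonneg
    nlinarith
  have hηinj : ∀ m n, η m = η n → m = n := by
    intro m n h
    simp only [hη_def] at h
    rw [div_eq_div_iff (by positivity) (by positivity)] at h
    have h' : (m : ℝ) = n := by nlinarith
    exact_mod_cast h'
  set e : ℕ → ℝ → ℝ := fun n t => c₀ - c₀ / 4 * (1 - Real.exp (-(4 * K / c₀) * t)) - η n * t ^ 2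
    with he_def
  set 𝓔 : Set (ℝ → ℝ) := Set.range e with h𝓔_def
  have he𝓔 : ∀ n, e n ∈ 𝓔 := fun n => ⟨n, rfl⟩
  have hfam : IsEnergyProfileFamily c₀ T₀ E₁ E₂ 𝓔 := by
    refine isEnergyProfileFamily_steepProfile hc₀ hT₀ hK0.le ?_ hη ?_ ?_
    · calc η₀ * T₀ ^ 2 ≤ c₀ / (4 * T₀ ^ 2) * T₀ ^ 2 :=
          mul_le_mul_of_nonneg_right (min_le_left _ _) (sq_nonneg _)
        _ = c₀ / 4 := by field_simp
    · have h1 : η₀ ≤ 1 / (2 * T₀) := (min_le_right _ _).trans (min_le_left _ _)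
      rw [le_div_iff₀ (by positivity)] at h1
      have h2 : c₀ * E₁ / T₀ = K + 1 := by rw [hE₁_def]; field_simp
      rw [h2]
      linarith
    · have h1 : η₀ ≤ 1 / 2 := (min_le_right _ _).trans (min_le_right _ _)
      have h2 : 4 * K ^ 2 / c₀ + 1 = c₀ * ((4 * K ^ 2 / c₀ + 1) * T₀ ^ 2 / c₀) / T₀ ^ 2 := by
        field_simp
      calc 4 * K ^ 2 / c₀ + 2 * η₀ ≤ 4 * K ^ 2 / c₀ + 1 := by linarith
        _ = c₀ * ((4 * K ^ 2 / c₀ + 1) * T₀ ^ 2 / c₀) / T₀ ^ 2 := h2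
        _ ≤ c₀ * E₂ / T₀ ^ 2 := by
            apply div_le_div_of_nonneg_right _ (sq_nonneg _)
            exact mul_le_mul_of_nonneg_left (le_max_right _ _) hc₀.le
  -- Step 3: the solutions of Prop. 2.2
  obtain ⟨v, hv, hv0⟩ := h22 E₁ E₂ 𝓔 hE₁1 hE₁E₂ hfam
  set B : ℝ := C * max (E₁ ^ (2 * α + 3 * ε)) (E₂ ^ ((2 * α + 4 * ε) / 3)) with hB_def
  have hB0 : 0 ≤ B := mul_nonneg hC.le (le_trans (by positivity) (le_max_left _ _))
  set D : ℝ := C₇ * B ^ 2 with hD_def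
  have hD0 : 0 ≤ D := by positivity
  have hD : 2 * D ≤ K / 3 := by
    have : 6 * D ≤ K := hKD
    linarith
  set w : ℕ → ℝ → UnitAddTorus (Fin 3) → EuclideanSpace ℝ (Fin 3) := fun n => v (e n) with hw_def
  have hcont : ∀ n, ContinuousOn (uncurry (w n)) (Icc 0 T₀ ×ˢ univ) := fun n =>
    (hv (e n) (he𝓔 n)).2.1
  have hweak : ∀ n, Torus.IsWeakFracNSSolutionOn T₀ α 1 (w n) := fun n => (hv (e n) (he𝓔 n)).1
  have henergy : ∀ n, ∀ t ∈ Icc 0 T₀, ∫ x, ‖w n t x‖ ^ 2 = e n t := fun n =>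
    (hv (e n) (he𝓔 n)).2.2.1
  have hbound : ∀ n, ∀ t ∈ Icc 0 T₀,
      eBoundedHolderNorm (Real.toNNReal (α + ε)) (w n t) ≤ ENNReal.ofReal B := fun n =>
    (hv (e n) (he𝓔 n)).2.2.2
  have hIcc : Icc 0 T ⊆ Icc 0 T₀ := Icc_subset_Icc_right hTT₀
  have hL2 : ∀ n, ∀ t ∈ Icc 0 T₀, MemLp (w n t) 2 volume := fun n t ht =>
    memLp_slice_of_continuousOn_slab (hcont n) ht
  -- the Hölder exponent `β = α + ε`
  set β : ℝ≥0 := Real.toNNReal (α + ε) with hβ_def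
  have hβ : (β : ℝ) = α + ε := Real.coe_toNNReal _ (by linarith)
  have hmemH : ∀ n, ∀ t ∈ Icc 0 T₀, MemHolder β (w n t) := fun n t ht =>
    eHolderNorm_lt_top.1 (((eHolderNorm_le_eBoundedHolderNorm β (w n t)).trans
      (hbound n t ht)).trans_lt ENNReal.ofReal_lt_top)
  -- Step 4: the dissipation bound on `[0, T₀]`
  have hdiss : ∀ n, ∀ t ∈ Icc 0 T₀, Torus.eFracDissipation α (w n t) ≤ ENNReal.ofReal D :=
    fun n t ht => eFracDissipation_le_of_cor72 hB0 hcor (hmemH n t ht) (hbound n t ht)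
  -- the datum
  have h0mem : (0 : ℝ) ∈ Icc 0 T₀ := ⟨le_rfl, hT₀.le⟩
  refine ⟨w 0 0, β, T, w, hL2 0 0 h0mem, ?_, ?_, ?_, hmemH 0 0 h0mem, hT, fun n =>
    (hcont n).mono (prod_mono hIcc Subset.rfl), ?_, ?_, fun n => (hweak n).of_le hTT₀, ?_, ?_⟩
  · -- weakly divergence-free datum (continuity from a.e. `t`)
    exact isWeaklyDivFree_of_continuousOn_slab hT₀ (hcont 0) (hweak 0).2.2.1 h0mem
  · rw [hβ]; linarith
  · rw [hβ]; exact hαε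
  · -- uniform Hölder constants on `[0, T]`
    intro n
    refine ⟨B.toNNReal, fun t ht => ?_⟩
    have hm := hmemH n t (hIcc ht)
    refine hm.holderWith.mono ?_
    rw [← ENNReal.coe_le_coe, hm.coe_nnHolderNorm_eq_eHolderNorm]
    exact (eHolderNorm_le_eBoundedHolderNorm β (w n t)).trans (hbound n t (hIcc ht))
  · -- common datum (Prop. 2.2 (d))
    intro n
    exact hv0 (e n) (he𝓔 n) (e 0) (he𝓔 0)
  · -- pairwise distinct on `[0, T]`: the energies differ at `t = T`
    intro m n hmn
    refine ⟨T, ⟨hT.le, le_rfl⟩, fun hEq => ?_⟩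
    have hTmem : T ∈ Icc 0 T₀ := ⟨hT.le, hTT₀⟩
    have h1 : e m T = e n T := by
      rw [← henergy m T hTmem, ← henergy n T hTmem, hEq]
    exact steepProfile_ne (fun h => hmn (hηinj m n h)) hT.ne' h1
  · -- Step 5: the energy inequality (3) on `0 ≤ s ≤ t ≤ T`
    intro n s t hs hst htT
    rcases hst.eq_or_lt with rfl | hlt
    · simp [Torus.FracEnergyIneq]
    · refine fracEnergyIneq_of_profile hTT₀ hD0 (hL2 n) (henergy n) (hdiss n) ?_ s t hs hlt htT
      -- the drop of the profile: slope `≤ -K/3` on `[0, T]`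
      intro s' t' hs' hlt' ht'T
      have hslope : ∀ x ∈ interior (Icc s' t'), deriv (e n) x ≤ -(K / 3) := by
        intro x hx
        rw [interior_Icc] at hx
        exact deriv_steepProfile_le hc₀ hK0.le (hη n).1 (hs'.trans hx.1.le)
          ((hx.2.le.trans ht'T).trans_eq hT_def)
      have hdiff : Differentiable ℝ (e n) := fun x =>
        (hasDerivAt_steepProfile hc₀.ne' K (η n) x).differentiableAt
      have hmvt := (convex_Icc s' t').image_sub_le_mul_sub_of_deriv_le
        hdiff.continuous.continuousOn hdiff.differentiableOn hslope s'
        (left_mem_Icc.2 hlt'.le) t' (right_mem_Icc.2 hlt'.le) hlt'.le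
      have hts : 0 ≤ t' - s' := sub_nonneg.2 hlt'.le
      nlinarith [mul_le_mul_of_nonneg_right hD hts]

/-! ## Thm. 1.2 from Prop. 2.2 alone -/

/-- **Colombo–De Lellis–De Rosa 2018, Thm. 1.2 from Prop. 2.2 alone**: combining
`ColomboDeLellisDeRosa2018_thm13_of_prop22` with `ColomboDeLellisDeRosa2018_thm12_of_thm13`
(Thm. 1.1 and the continuation remark discharged), the named fact
`ColomboDeLellisDeRosa2018_thm12` (for `α < 1/5` some divergence-free `v̄ ∈ L²(𝕋³)` carries
infinitely many Leray solutions) is reduced to the convex-integration proposition Prop. 2.2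
(`Literature.Analysis.FluidPDE.ColomboDeLellisDeRosa2018_prop22`).
[cite: ColomboDelellisDerosa2018, §1 p. 3 and §2 pp. 5–6] -/
theorem ColomboDeLellisDeRosa2018_thm12_of_prop22 (h22 : ColomboDeLellisDeRosa2018_prop22) :
    ColomboDeLellisDeRosa2018_thm12 :=
  ColomboDeLellisDeRosa2018_thm12_of_thm13 (ColomboDeLellisDeRosa2018_thm13_of_prop22 h22)

end Literature.Barriers.NavierStokesRegularity
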